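import Summits.Ventures.PercRepro.RLSGenericT0Sums
import Summits.Ventures.PercRepro.RLSPairSumsT2
import Summits.Ventures.PercRepro.RLSClassSumsT1

/-!
# C-025 at q = 3: P₂ at t = 0 under R₃⁺ — the witness sums of the loss cases (night-3)

At a flat `G` of type `t = 0` (the complement spans: outside points `W`, a basis of size `p = n + 4`; witnesses `X ⊆ W`, `1 ≤ |X| ≤ p − 4`)
every subset `B′ ⊆ G` of rank 3 and size ≥ 4 has R₃⁺-share ≥ R₃-share in every witness EXCEPT in the loss cases of
proofs/N3-R3PLUS-plan.md §1: (L1) `B′ = ℓ ∪ {a}` (`|ℓ| ≥ 4`) on witnesses with two W-points of one class of planes through `ℓ`,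
(L2) `B′ = ℓ ∪ {a,a′}` on witnesses containing a 3-class through `ℓ` (a pair only ties it), (L3) `B′ = ℓ₃ ∪ {a}` / `ℓ₃ ∪ {a,a′}` on witnesses containing a
3-class through the 3-line `ℓ₃`.  The classes of one line have `Σ(c_j − 1) ≤ 2` (W is a basis), so a line carries one 3-class or
≤ 2 pairs.  Each theorem below bounds the R₃⁺ supply of such a `B′` from below by the share it keeps on the witnesses that are
not lost — the tie share `1/(x+1)` (near-pencils), the share 1 (`ℓ ∪ {a,a′}`, on the witnesses without two points of one class), the pure R₃ share `ρ₃/C(b+x,3)` (𝒯₀ sets) — and shows it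
is ≥ `Φ(p,3)` for every `p ≥ 8`; with Theorem 25 (`Φ` = the supply of a triple) and `R₃⁺ ≥ R₃` elsewhere this is P₂ at `t = 0`,
modulo the loss-case classification (paper).  Sums of `RLSGenericT0Sums` (outside count `n + 4`), `RLSPairSumsT2`, `RLSClassSumsT1`.
Each inequality: closed forms → `(2^n·P(m) + Q(m))/L(m) ≥ 0` with positive coefficients (directly, or after `2^{m+s} ≥ 2^s·(1 + m)`,
`≥ 2^s·(1 + m + C(m,2))`, `≥ 2^s·(1 + m + C(m,2) + C(m,3))`).  No `decide`.
-/

open PercRepro.NightThree.CF PercRepro.NightThree.U0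

namespace PercRepro.NightThree.U0

open Finset

/-- `Σ_{y<0} C(N,y) = 0`. -/
theorem sum_range_zero' (N : ℕ) : (∑ y ∈ range 0, (N.choose y : ℚ)) = 0 := by simp

/-- `(N+1)·C(N,i+1)/(i+2) = C(N+1,i+2)`. -/
theorem term_a (N i : ℕ) : (N.choose (i + 1) : ℚ) / ((i : ℚ) + 2) = ((N + 1).choose (i + 2) : ℚ) / ((N : ℚ) + 1) := by
  have h := Nat.add_one_mul_choose_eq N (i + 1)
  have e : ((N : ℚ) + 1) * (N.choose (i + 1) : ℚ) = ((N + 1).choose (i + 2) : ℚ) * ((i : ℚ) + 2) := by exact_mod_cast h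
  have hi : ((i : ℚ) + 2) ≠ 0 := by positivity
  have hN : ((N : ℚ) + 1) ≠ 0 := by positivity
  rw [div_eq_div_iff hi hN]
  linear_combination e

/-- `C(N,i)/(i+2) = (C(N+1,i+1) − C(N+2,i+2)/(N+2))/(N+1)`. -/
theorem term_b (N i : ℕ) : (N.choose i : ℚ) / ((i : ℚ) + 2) =
    (((N + 1).choose (i + 1) : ℚ) - ((N + 2).choose (i + 2) : ℚ) / ((N : ℚ) + 2)) / ((N : ℚ) + 1) := by
  have h1 := Nat.add_one_mul_choose_eq N i
  have h2 := Nat.add_one_mul_choose_eq (N + 1) (i + 1)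
  have e1 : ((N : ℚ) + 1) * (N.choose i : ℚ) = ((N + 1).choose (i + 1) : ℚ) * ((i : ℚ) + 1) := by exact_mod_cast h1
  have e2 : ((N : ℚ) + 2) * ((N + 1).choose (i + 1) : ℚ) = ((N + 2).choose (i + 2) : ℚ) * ((i : ℚ) + 2) := by
    rw [show N + 1 + 1 = N + 2 by omega, show i + 1 + 1 = i + 2 by omega] at h2; exact_mod_cast h2
  have hi : ((i : ℚ) + 2) ≠ 0 := by positivity
  have hN : ((N : ℚ) + 1) ≠ 0 := by positivity
  have hN2 : ((N : ℚ) + 2) ≠ 0 := by positivity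
  field_simp
  linear_combination ((N : ℚ) + 2) * e1 - e2

/-- `Σ_{i<n} C(n+2, i+2)` in closed form. -/
theorem lv_2_2 (n : ℕ) :
    (∑ i ∈ range n, ((n + 2).choose (i + 2) : ℚ)) = 2 ^ (n + 2) - (1 + (((n + 2) : ℕ) : ℚ)) - (1) := by
  rw [sum_choose_shift (n + 2) 2 n, sum_choose_Ico (n + 2) 2 (2 + n) (by omega) (by omega)]
  have ht := sum_choose_tail (n + 2) 1 (by omega)
  rw [show (n + 2) + 1 - 1 = 2 + n by omega] at ht
  rw [ht, sum_range_two, sum_range_one]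

/-- `Σ_{i<n} C(n+2, i+1)` in closed form. -/
theorem lv_2_1 (n : ℕ) :
    (∑ i ∈ range n, ((n + 2).choose (i + 1) : ℚ)) = 2 ^ (n + 2) - (1) - (1 + (((n + 2) : ℕ) : ℚ)) := by
  rw [sum_choose_shift (n + 2) 1 n, sum_choose_Ico (n + 2) 1 (1 + n) (by omega) (by omega)]
  have ht := sum_choose_tail (n + 2) 2 (by omega)
  rw [show (n + 2) + 1 - 2 = 1 + n by omega] at ht
  rw [ht, sum_range_one, sum_range_two]

/-- `Σ_{i<n} C(n+3, i+2)` in closed form. -/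
theorem lv_3_2 (n : ℕ) :
    (∑ i ∈ range n, ((n + 3).choose (i + 2) : ℚ)) = 2 ^ (n + 3) - (1 + (((n + 3) : ℕ) : ℚ)) - (1 + (((n + 3) : ℕ) : ℚ)) := by
  rw [sum_choose_shift (n + 3) 2 n, sum_choose_Ico (n + 3) 2 (2 + n) (by omega) (by omega)]
  have ht := sum_choose_tail (n + 3) 2 (by omega)
  rw [show (n + 3) + 1 - 2 = 2 + n by omega] at ht
  rw [ht, sum_range_two]

/-- `Σ_{i<n} C(n+1, i+2)` in closed form. -/
theorem lv_1_2 (n : ℕ) :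
    (∑ i ∈ range n, ((n + 1).choose (i + 2) : ℚ)) = 2 ^ (n + 1) - (1 + (((n + 1) : ℕ) : ℚ)) - (0) := by
  rw [sum_choose_shift (n + 1) 2 n, sum_choose_Ico (n + 1) 2 (2 + n) (by omega) (by omega)]
  have ht := sum_choose_tail (n + 1) 0 (by omega)
  rw [show (n + 1) + 1 - 0 = 2 + n by omega] at ht
  rw [ht, sum_range_two, sum_range_zero']

/-- `Σ_{i<n} C(n+1, i+1)` in closed form. -/
theorem lv_1_1 (n : ℕ) :
    (∑ i ∈ range n, ((n + 1).choose (i + 1) : ℚ)) = 2 ^ (n + 1) - (1) - (1) := by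
  rw [sum_choose_shift (n + 1) 1 n, sum_choose_Ico (n + 1) 1 (1 + n) (by omega) (by omega)]
  have ht := sum_choose_tail (n + 1) 1 (by omega)
  rw [show (n + 1) + 1 - 1 = 1 + n by omega] at ht
  rw [ht, sum_range_one]

/-- `Σ_{i<n} C(n+1, i+0)` in closed form. -/
theorem lv_1_0 (n : ℕ) :
    (∑ i ∈ range n, ((n + 1).choose i : ℚ)) = 2 ^ (n + 1) - (0) - (1 + (((n + 1) : ℕ) : ℚ)) := by
  rw [range_eq_Ico, sum_choose_Ico (n + 1) 0 (n) (by omega) (by omega)]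
  have ht := sum_choose_tail (n + 1) 2 (by omega)
  rw [show (n + 1) + 1 - 2 = n by omega] at ht
  rw [ht, sum_range_zero', sum_range_two]

/-- `Σ_{i<n} C(n+0, i+1)` in closed form. -/
theorem lv_0_1 (n : ℕ) :
    (∑ i ∈ range n, (n.choose (i + 1) : ℚ)) = 2 ^ n - (1) - (0) := by
  rw [sum_choose_shift n 1 n, sum_choose_Ico n 1 (1 + n) (by omega) (by omega)]
  have ht := sum_choose_tail n 0 (by omega)
  rw [show n + 1 - 0 = 1 + n by omega] at ht
  rw [ht, sum_range_one, sum_range_zero']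

/-- `Σ_{i<n} C(n+0, i+0)` in closed form. -/
theorem lv_0_0 (n : ℕ) :
    (∑ i ∈ range n, (n.choose i : ℚ)) = 2 ^ n - (0) - (1) := by
  rw [range_eq_Ico, sum_choose_Ico n 0 (n) (by omega) (by omega)]
  have ht := sum_choose_tail n 1 (by omega)
  rw [show n + 1 - 1 = n by omega] at ht
  rw [ht, sum_range_zero', sum_range_one]

/-- (L1), one 3-class: the free-witness tie sum `Σ_{x=1}^{p−4} (C(p−3,x) + 3C(p−3,x−1))/(x+1)` (`x = i + 1`). -/
def l1aSum (n : ℕ) : ℚ := ∑ i ∈ range n, (((n + 1).choose (i + 1) : ℚ) + 3 * ((n + 1).choose i : ℚ)) / ((i : ℚ) + 2)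

/-- (L1), two 2-classes: `Σ_{x=1}^{p−4} (C(p−4,x) + 4C(p−4,x−1))/(x+1) + 4·Σ_{x=2}^{p−4} C(p−4,x−2)/(x+1)` (`U2.ptSum` = the last sum). -/
def l1bSum (n : ℕ) : ℚ := (∑ i ∈ range n, ((n.choose (i + 1) : ℚ) + 4 * (n.choose i : ℚ)) / ((i : ℚ) + 2)) + 4 * U2.ptSum n

/-- (L2), one 3-class: the witnesses with ≤ 1 class point, `Σ_{x=1}^{p−4} (C(p−3,x) + 3C(p−3,x−1))`. -/
def l2aSum (n : ℕ) : ℚ := ∑ i ∈ range n, (((n + 1).choose (i + 1) : ℚ) + 3 * ((n + 1).choose i : ℚ))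

/-- (L2), two 2-classes: the witnesses with no full pair, `Σ_{x=1}^{p−4} (C(p−4,x) + 4C(p−4,x−1)) + 4·Σ_{x=2}^{p−4} C(p−4,x−2)` (`U2.pwSum`). -/
def l2bSum (n : ℕ) : ℚ := (∑ i ∈ range n, ((n.choose (i + 1) : ℚ) + 4 * (n.choose i : ℚ))) + 4 * U2.pwSum n

/-- Their pure share for a lined 4-set: `Σ_{x=3}^{p−4} C(p−3,x−3)/C(x+4,3)`. -/
def lost4Sum (n : ℕ) : ℚ := ∑ j ∈ range (n - 2), ((n + 1).choose j : ℚ) / ((j + 7).choose 3 : ℚ)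

/-- Their pure share for a 5-set: `Σ_{x=3}^{p−4} C(p−3,x−3)/C(x+5,3)`. -/
def lost5Sum (n : ℕ) : ℚ := ∑ j ∈ range (n - 2), ((n + 1).choose j : ℚ) / ((j + 8).choose 3 : ℚ)

/-- `l1aSum` in closed form. -/
theorem l1a_closed (n : ℕ) : l1aSum n =
    (2 ^ (n + 2) - (1 + (((n + 2) : ℕ) : ℚ)) - (1)) / ((n : ℚ) + 2)
      + 3 * (((2 ^ (n + 2) - (1) - (1 + (((n + 2) : ℕ) : ℚ))) - (2 ^ (n + 3) - (1 + (((n + 3) : ℕ) : ℚ)) - (1 + (((n + 3) : ℕ) : ℚ))) / ((n : ℚ) + 3)) / ((n : ℚ) + 2)) := by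
  unfold l1aSum
  have hterm : ∀ i ∈ range n, (((n + 1).choose (i + 1) : ℚ) + 3 * ((n + 1).choose i : ℚ)) / ((i : ℚ) + 2) =
      ((n + 2).choose (i + 2) : ℚ) / ((n : ℚ) + 2) + 3 * ((((n + 2).choose (i + 1) : ℚ) - ((n + 3).choose (i + 2) : ℚ) / ((n : ℚ) + 3)) / ((n : ℚ) + 2)) := by
    intro i _
    rw [add_div, mul_div_assoc, term_a (n + 1) i, term_b (n + 1) i]
    push_cast; ring_nf
  rw [sum_congr rfl hterm, sum_add_distrib, ← sum_div, ← mul_sum, ← sum_div, sum_sub_distrib, ← sum_div, lv_2_2, lv_2_1, lv_3_2]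

/-- `l1bSum` in closed form. -/
theorem l1b_closed (n : ℕ) (hn : 1 ≤ n) : l1bSum n =
    (2 ^ (n + 1) - (1 + (((n + 1) : ℕ) : ℚ)) - (0)) / ((n : ℚ) + 1)
      + 4 * (((2 ^ (n + 1) - (1) - (1)) - (2 ^ (n + 2) - (1 + (((n + 2) : ℕ) : ℚ)) - (1)) / ((n : ℚ) + 2)) / ((n : ℚ) + 1))
      + 4 * U2.ptP n := by
  unfold l1bSum
  rw [U2.pt_eq_P n hn]
  have hterm : ∀ i ∈ range n, ((n.choose (i + 1) : ℚ) + 4 * (n.choose i : ℚ)) / ((i : ℚ) + 2) =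
      ((n + 1).choose (i + 2) : ℚ) / ((n : ℚ) + 1) + 4 * ((((n + 1).choose (i + 1) : ℚ) - ((n + 2).choose (i + 2) : ℚ) / ((n : ℚ) + 2)) / ((n : ℚ) + 1)) := by
    intro i _
    rw [add_div, mul_div_assoc, term_a n i, term_b n i]
  rw [sum_congr rfl hterm, sum_add_distrib, ← sum_div, ← mul_sum, ← sum_div, sum_sub_distrib, ← sum_div, lv_1_2, lv_1_1, lv_2_2]

/-- `l2aSum` in closed form. -/
theorem l2a_closed (n : ℕ) : l2aSum n = (2 ^ (n + 1) - (1) - (1)) + 3 * (2 ^ (n + 1) - (0) - (1 + (((n + 1) : ℕ) : ℚ))) := by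
  unfold l2aSum
  rw [sum_add_distrib, ← mul_sum, lv_1_1, lv_1_0]

/-- `l2bSum` in closed form (`n ≥ 1`). -/
theorem l2b_closed (n : ℕ) (hn : 1 ≤ n) : l2bSum n = (2 ^ n - (1) - (0)) + 4 * (2 ^ n - (0) - (1)) + 4 * U2.pwP n := by
  unfold l2bSum
  rw [U2.pw_eq_P n hn, sum_add_distrib, ← mul_sum, lv_0_1, lv_0_0]

/-- Pascal split on `range (n − 2)` with top `n + 1`. -/
theorem pascal_split' (n : ℕ) (f : ℕ → ℚ) :
    (∑ j ∈ range (n - 2), ((n + 1).choose j : ℚ) * f j) =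
      (∑ j ∈ range (n - 2), ((n + 2).choose (j + 1) : ℚ) * f j) - ∑ j ∈ range (n - 2), ((n + 1).choose (j + 1) : ℚ) * f j := by
  rw [← sum_sub_distrib]
  apply sum_congr rfl
  intro j _
  rw [show n + 2 = (n + 1) + 1 by omega, Nat.choose_succ_succ']; push_cast; ring

/-- `Σ_{i<n−2} C(n+5, i+4)` in closed form (`n ≥ 2`). -/
theorem level_2_0 (n : ℕ) (hn : 2 ≤ n) :
    (∑ i ∈ range (n - 2), ((n + 5).choose (i + 4) : ℚ)) = 2 ^ (n + 5) - (1 + (((n + 5) : ℕ) : ℚ) + ((n + 5).choose 2 : ℚ) + ((n + 5).choose 3 : ℚ)) - (1 + (((n + 5) : ℕ) : ℚ) + ((n + 5).choose 2 : ℚ) + ((n + 5).choose 3 : ℚ)) := by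
  rw [sum_choose_shift (n + 5) 4 (n - 2), sum_choose_Ico (n + 5) 4 (4 + (n - 2)) (by omega) (by omega)]
  have ht := sum_choose_tail (n + 5) 4 (by omega)
  rw [show n + 5 + 1 - 4 = 4 + (n - 2) by omega] at ht
  rw [ht, sum_range_four]

/-- `Σ_{i<n−2} C(n+6, i+5)` in closed form (`n ≥ 2`). -/
theorem level_2_1 (n : ℕ) (hn : 2 ≤ n) :
    (∑ i ∈ range (n - 2), ((n + 6).choose (i + 5) : ℚ)) = 2 ^ (n + 6) - (1 + (((n + 6) : ℕ) : ℚ) + ((n + 6).choose 2 : ℚ) + ((n + 6).choose 3 : ℚ) + ((n + 6).choose 4 : ℚ)) - (1 + (((n + 6) : ℕ) : ℚ) + ((n + 6).choose 2 : ℚ) + ((n + 6).choose 3 : ℚ)) := by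
  rw [sum_choose_shift (n + 6) 5 (n - 2), sum_choose_Ico (n + 6) 5 (5 + (n - 2)) (by omega) (by omega)]
  have ht := sum_choose_tail (n + 6) 4 (by omega)
  rw [show n + 6 + 1 - 4 = 5 + (n - 2) by omega] at ht
  rw [ht, sum_range_five, sum_range_four]

/-- `Σ_{i<n−2} C(n+7, i+6)` in closed form (`n ≥ 2`). -/
theorem level_2_2 (n : ℕ) (hn : 2 ≤ n) :
    (∑ i ∈ range (n - 2), ((n + 7).choose (i + 6) : ℚ)) = 2 ^ (n + 7) - (1 + (((n + 7) : ℕ) : ℚ) + ((n + 7).choose 2 : ℚ) + ((n + 7).choose 3 : ℚ) + ((n + 7).choose 4 : ℚ) + ((n + 7).choose 5 : ℚ)) - (1 + (((n + 7) : ℕ) : ℚ) + ((n + 7).choose 2 : ℚ) + ((n + 7).choose 3 : ℚ)) := by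
  rw [sum_choose_shift (n + 7) 6 (n - 2), sum_choose_Ico (n + 7) 6 (6 + (n - 2)) (by omega) (by omega)]
  have ht := sum_choose_tail (n + 7) 4 (by omega)
  rw [show n + 7 + 1 - 4 = 6 + (n - 2) by omega] at ht
  rw [ht, sum_range_six, sum_range_four]

/-- `Σ_{i<n−2} C(n+8, i+7)` in closed form (`n ≥ 2`). -/
theorem level_2_3 (n : ℕ) (hn : 2 ≤ n) :
    (∑ i ∈ range (n - 2), ((n + 8).choose (i + 7) : ℚ)) = 2 ^ (n + 8) - (1 + (((n + 8) : ℕ) : ℚ) + ((n + 8).choose 2 : ℚ) + ((n + 8).choose 3 : ℚ) + ((n + 8).choose 4 : ℚ) + ((n + 8).choose 5 : ℚ) + ((n + 8).choose 6 : ℚ)) - (1 + (((n + 8) : ℕ) : ℚ) + ((n + 8).choose 2 : ℚ) + ((n + 8).choose 3 : ℚ)) := by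
  rw [sum_choose_shift (n + 8) 7 (n - 2), sum_choose_Ico (n + 8) 7 (7 + (n - 2)) (by omega) (by omega)]
  have ht := sum_choose_tail (n + 8) 4 (by omega)
  rw [show n + 8 + 1 - 4 = 7 + (n - 2) by omega] at ht
  rw [ht, U1.sum_range_seven, sum_range_four]

/-- `Σ_{i<n−2} C(n+9, i+8)` in closed form (`n ≥ 2`). -/
theorem level_2_4 (n : ℕ) (hn : 2 ≤ n) :
    (∑ i ∈ range (n - 2), ((n + 9).choose (i + 8) : ℚ)) = 2 ^ (n + 9) - (1 + (((n + 9) : ℕ) : ℚ) + ((n + 9).choose 2 : ℚ) + ((n + 9).choose 3 : ℚ) + ((n + 9).choose 4 : ℚ) + ((n + 9).choose 5 : ℚ) + ((n + 9).choose 6 : ℚ) + ((n + 9).choose 7 : ℚ)) - (1 + (((n + 9) : ℕ) : ℚ) + ((n + 9).choose 2 : ℚ) + ((n + 9).choose 3 : ℚ)) := by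
  rw [sum_choose_shift (n + 9) 8 (n - 2), sum_choose_Ico (n + 9) 8 (8 + (n - 2)) (by omega) (by omega)]
  have ht := sum_choose_tail (n + 9) 4 (by omega)
  rw [show n + 9 + 1 - 4 = 8 + (n - 2) by omega] at ht
  rw [ht, U1.sum_range_eight, sum_range_four]

/-- `Σ_{i<n−2} C(n+2, i+1)/C(i+7,3)` in closed form (`n ≥ 2`). -/
theorem texp_7_2 (n : ℕ) (hn : 2 ≤ n) :
    (∑ i ∈ range (n - 2), ((n + 2).choose (i + 1) : ℚ) / ((i + 7).choose 3 : ℚ)) = (1 : ℚ) * ((2 ^ (n + 5) - (1 + (((n + 5) : ℕ) : ℚ) + ((n + 5).choose 2 : ℚ) + ((n + 5).choose 3 : ℚ)) - (1 + (((n + 5) : ℕ) : ℚ) + ((n + 5).choose 2 : ℚ) + ((n + 5).choose 3 : ℚ))) / ((n + 5).choose 3 : ℚ)) + (-(9/4) : ℚ) * ((2 ^ (n + 6) - (1 + (((n + 6) : ℕ) : ℚ) + ((n + 6).choose 2 : ℚ) + ((n + 6).choose 3 : ℚ) + ((n + 6).choose 4 : ℚ)) - (1 + (((n + 6) : ℕ)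 : ℚ) + ((n + 6).choose 2 : ℚ) + ((n + 6).choose 3 : ℚ))) / ((n + 6).choose 4 : ℚ)) + (9/5 : ℚ) * ((2 ^ (n + 7) - (1 + (((n + 7) : ℕ) : ℚ) + ((n + 7).choose 2 : ℚ) + ((n + 7).choose 3 : ℚ) + ((n + 7).choose 4 : ℚ) + ((n + 7).choose 5 : ℚ)) - (1 + (((n + 7) : ℕ) : ℚ) + ((n + 7).choose 2 : ℚ) + ((n + 7).choose 3 : ℚ))) / ((n + 7).choose 5 : ℚ)) + (-(1/2) : ℚ) * ((2 ^ (n + 8) - (1 + (((n + 8) : ℕ) : ℚ) + ((n + 8).choose 2 : ℚ) + ((n + 8).choose 3 : ℚ) + ((n + 8).choose 4 : ℚ) + ((n + 8).choose 5 : ℚ) + ((n + 8).choose 6 : ℚ)) - (1 + (((n + 8) : ℕ) : ℚ) + ((n + 8).choose 2 : ℚ) + ((n + 8).choose 3 : ℚ))) / ((n + 8).choose 6 : ℚ)) := by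
  have hterm : ∀ i ∈ range (n - 2), ((n + 2).choose (i + 1) : ℚ) / ((i + 7).choose 3 : ℚ) =
      (1 : ℚ) * (((n + 2 + 3).choose (i + 4) : ℚ) / ((n + 2 + 3).choose 3 : ℚ)) + (-(9/4) : ℚ) * (((n + 2 + 4).choose (i + 5) : ℚ) / ((n + 2 + 4).choose 4 : ℚ)) + (9/5 : ℚ) * (((n + 2 + 5).choose (i + 6) : ℚ) / ((n + 2 + 5).choose 5 : ℚ)) + (-(1/2) : ℚ) * (((n + 2 + 6).choose (i + 7) : ℚ) / ((n + 2 + 6).choose 6 : ℚ)) := by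
    intro i _
    rw [div_eq_mul_one_div, U1.inv_choose_7, ← U1.ratio_0 (n + 2), ← U1.ratio_1 (n + 2), ← U1.ratio_2 (n + 2), ← U1.ratio_3 (n + 2)]; ring
  rw [sum_congr rfl hterm]
  simp only [sum_add_distrib, ← mul_sum, ← sum_div]
  simp only [show ∀ j : ℕ, n + 2 + j = n + (2 + j) from fun j => by omega]
  rw [level_2_0 n hn, level_2_1 n hn, level_2_2 n hn, level_2_3 n hn]

/-- `Σ_{i<n−2} C(n+2, i+1)/C(i+8,3)` in closed form (`n ≥ 2`). -/
theorem texp_8_2 (n : ℕ) (hn : 2 ≤ n) :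
    (∑ i ∈ range (n - 2), ((n + 2).choose (i + 1) : ℚ) / ((i + 8).choose 3 : ℚ)) = (1 : ℚ) * ((2 ^ (n + 5) - (1 + (((n + 5) : ℕ) : ℚ) + ((n + 5).choose 2 : ℚ) + ((n + 5).choose 3 : ℚ)) - (1 + (((n + 5) : ℕ) : ℚ) + ((n + 5).choose 2 : ℚ) + ((n + 5).choose 3 : ℚ))) / ((n + 5).choose 3 : ℚ)) + (-3 : ℚ) * ((2 ^ (n + 6) - (1 + (((n + 6) : ℕ) : ℚ) + ((n + 6).choose 2 : ℚ) + ((n + 6).choose 3 : ℚ) + ((n + 6).choose 4 : ℚ)) - (1 + (((n + 6) : ℕ) : ℚ) + ((n + 6).choose 2 : ℚ) + ((n + 6).choose 3 : ℚ))) / ((n + 6).choose 4 : ℚ)) + (18/5 : ℚ) * ((2 ^ (n + 7) - (1 + (((n + 7) : ℕ) : ℚ) + ((n + 7).choose 2 : ℚ) + ((n + 7).choose 3 : ℚ) + ((n + 7).choose 4 : ℚ) + ((n + 7).choose 5 : ℚ)) - (1 + (((n + 7) : ℕ) : ℚ) + ((n + 7).choose 2 : ℚ) + ((n + 7).choose 3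 : ℚ))) / ((n + 7).choose 5 : ℚ)) + (-2 : ℚ) * ((2 ^ (n + 8) - (1 + (((n + 8) : ℕ) : ℚ) + ((n + 8).choose 2 : ℚ) + ((n + 8).choose 3 : ℚ) + ((n + 8).choose 4 : ℚ) + ((n + 8).choose 5 : ℚ) + ((n + 8).choose 6 : ℚ)) - (1 + (((n + 8) : ℕ) : ℚ) + ((n + 8).choose 2 : ℚ) + ((n + 8).choose 3 : ℚ))) / ((n + 8).choose 6 : ℚ)) + (3/7 : ℚ) * ((2 ^ (n + 9) - (1 + (((n + 9) : ℕ) : ℚ) + ((n + 9).choose 2 : ℚ) + ((n + 9).choose 3 : ℚ) + ((n + 9).choose 4 : ℚ) + ((n + 9).choose 5 : ℚ) + ((n + 9).choose 6 : ℚ) + ((n + 9).choose 7 : ℚ)) - (1 + (((n + 9) : ℕ) : ℚ) + ((n + 9).choose 2 : ℚ) + ((n + 9).choose 3 : ℚ))) / ((n + 9).choose 7 : ℚ)) := by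
  have hterm : ∀ i ∈ range (n - 2), ((n + 2).choose (i + 1) : ℚ) / ((i + 8).choose 3 : ℚ) =
      (1 : ℚ) * (((n + 2 + 3).choose (i + 4) : ℚ) / ((n + 2 + 3).choose 3 : ℚ)) + (-3 : ℚ) * (((n + 2 + 4).choose (i + 5) : ℚ) / ((n + 2 + 4).choose 4 : ℚ)) + (18/5 : ℚ) * (((n + 2 + 5).choose (i + 6) : ℚ) / ((n + 2 + 5).choose 5 : ℚ)) + (-2 : ℚ) * (((n + 2 + 6).choose (i + 7) : ℚ) / ((n + 2 + 6).choose 6 : ℚ)) + (3/7 : ℚ) * (((n + 2 + 7).choose (i + 8) : ℚ) / ((n + 2 + 7).choose 7 : ℚ)) := by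
    intro i _
    rw [div_eq_mul_one_div, U1.inv_choose_8, ← U1.ratio_0 (n + 2), ← U1.ratio_1 (n + 2), ← U1.ratio_2 (n + 2), ← U1.ratio_3 (n + 2), ← U1.ratio_4 (n + 2)]; ring
  rw [sum_congr rfl hterm]
  simp only [sum_add_distrib, ← mul_sum, ← sum_div]
  simp only [show ∀ j : ℕ, n + 2 + j = n + (2 + j) from fun j => by omega]
  rw [level_2_0 n hn, level_2_1 n hn, level_2_2 n hn, level_2_3 n hn, level_2_4 n hn]

/-- `lost4Sum` after the Pascal split. -/
theorem lost4_closed (n : ℕ) : lost4Sum n =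
    (∑ j ∈ range (n - 2), ((n + 2).choose (j + 1) : ℚ) / ((j + 7).choose 3 : ℚ)) - ∑ j ∈ range (n - 2), ((n + 1).choose (j + 1) : ℚ) / ((j + 7).choose 3 : ℚ) := by
  unfold lost4Sum
  have := pascal_split' n (fun j => 1 / ((j + 7).choose 3 : ℚ))
  simp only [mul_one_div] at this
  exact this

/-- `lost5Sum` after the Pascal split. -/
theorem lost5_closed (n : ℕ) : lost5Sum n =
    (∑ j ∈ range (n - 2), ((n + 2).choose (j + 1) : ℚ) / ((j + 8).choose 3 : ℚ)) - ∑ j ∈ range (n - 2), ((n + 1).choose (j + 1) : ℚ) / ((j + 8).choose 3 : ℚ) := by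
  unfold lost5Sum
  have := pascal_split' n (fun j => 1 / ((j + 8).choose 3 : ℚ))
  simp only [mul_one_div] at this
  exact this

/-- `l1aSum` as a rational function. -/
def l1aP (n : ℕ) : ℚ :=
    (4 * 2 ^ n - (1 + ((n : ℚ) + 2)) - (1)) / ((n : ℚ) + 2)
      + 3 * (((4 * 2 ^ n - (1) - (1 + ((n : ℚ) + 2))) - (8 * 2 ^ n - (1 + ((n : ℚ) + 3)) - (1 + ((n : ℚ) + 3))) / ((n : ℚ) + 3)) / ((n : ℚ) + 2))

/-- `l1bSum` as a rational function. -/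
def l1bP (n : ℕ) : ℚ :=
    (2 * 2 ^ n - (1 + ((n : ℚ) + 1)) - (0)) / ((n : ℚ) + 1)
      + 4 * (((2 * 2 ^ n - (1) - (1)) - (4 * 2 ^ n - (1 + ((n : ℚ) + 2)) - (1)) / ((n : ℚ) + 2)) / ((n : ℚ) + 1))
      + 4 * U2.ptP n

/-- `l2aSum` as a rational function. -/
def l2aP (n : ℕ) : ℚ := (2 * 2 ^ n - (1) - (1)) + 3 * (2 * 2 ^ n - (0) - (1 + ((n : ℚ) + 1)))

/-- `l2bSum` as a rational function. -/
def l2bP (n : ℕ) : ℚ := (2 ^ n - (1) - (0)) + 4 * (2 ^ n - (0) - (1)) + 4 * U2.pwP n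

/-- `lost4Sum` as a rational function. -/
def lost4P (n : ℕ) : ℚ := ((1 : ℚ) * ((32 * 2 ^ n - (1 + ((n : ℚ) + 5) + (((n : ℚ) + 5) * ((n : ℚ) + 4) / 2) + (((n : ℚ) + 5) * ((n : ℚ) + 4) * ((n : ℚ) + 3) / 6)) - (1 + ((n : ℚ) + 5) + (((n : ℚ) + 5) * ((n : ℚ) + 4) / 2) + (((n : ℚ) + 5) * ((n : ℚ) + 4) * ((n : ℚ) + 3) / 6))) / (((n : ℚ) + 5) * ((n : ℚ) + 4) * ((n : ℚ) + 3) / 6)) + (-(9/4) : ℚ) * ((64 * 2 ^ n - (1 + ((n : ℚ) + 6) + (((n : ℚ) + 6) * ((n : ℚ) + 5) / 2) + (((n : ℚ) + 6) * ((n : ℚ) + 5) * ((n : ℚ) + 4) / 6) + (((n : ℚ) + 6) * ((n : ℚ) + 5) * ((n : ℚ) + 4) * ((n : ℚ) + 3) / 24)) - (1 + ((n : ℚ) + 6) + (((n : ℚ) + 6) * ((n : ℚ) + 5) / 2) + (((n : ℚ) + 6) * ((n : ℚ) + 5) * ((n : ℚ) + 4) / 6))) / (((n : ℚ) + 6) *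 ((n : ℚ) + 5) * ((n : ℚ) + 4) * ((n : ℚ) + 3) / 24)) + (9/5 : ℚ) * ((128 * 2 ^ n - (1 + ((n : ℚ) + 7) + (((n : ℚ) + 7) * ((n : ℚ) + 6) / 2) + (((n : ℚ) + 7) * ((n : ℚ) + 6) * ((n : ℚ) + 5) / 6) + (((n : ℚ) + 7) * ((n : ℚ) + 6) * ((n : ℚ) + 5) * ((n : ℚ) + 4) / 24) + (((n : ℚ) + 7) * ((n : ℚ) + 6) * ((n : ℚ) + 5) * ((n : ℚ) + 4) * ((n : ℚ) + 3) / 120)) - (1 + ((n : ℚ) + 7) + (((n : ℚ) + 7) * ((n : ℚ) + 6) / 2) + (((n : ℚ) + 7) * ((n : ℚ) + 6) * ((n : ℚ) + 5) / 6))) / (((n : ℚ) + 7) * ((n : ℚ) + 6) * ((n : ℚ) + 5) * ((n : ℚ) + 4) * ((n : ℚ) + 3) / 120)) + (-(1/2) : ℚ) * ((256 * 2 ^ n - (1 + ((n : ℚ) + 8) + (((n : ℚ) + 8) * ((n : ℚ) + 7) / 2) + (((n : ℚ) + 8) * ((n : ℚ) + 7) * ((n : ℚ) + 6) / 6) + (((n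 : ℚ) + 8) * ((n : ℚ) + 7) * ((n : ℚ) + 6) * ((n : ℚ) + 5) / 24) + (((n : ℚ) + 8) * ((n : ℚ) + 7) * ((n : ℚ) + 6) * ((n : ℚ) + 5) * ((n : ℚ) + 4) / 120) + (((n : ℚ) + 8) * ((n : ℚ) + 7) * ((n : ℚ) + 6) * ((n : ℚ) + 5) * ((n : ℚ) + 4) * ((n : ℚ) + 3) / 720)) - (1 + ((n : ℚ) + 8) + (((n : ℚ) + 8) * ((n : ℚ) + 7) / 2) + (((n : ℚ) + 8) * ((n : ℚ) + 7) * ((n : ℚ) + 6) / 6))) / (((n : ℚ) + 8) * ((n : ℚ) + 7) * ((n : ℚ) + 6) * ((n : ℚ) + 5) * ((n : ℚ) + 4) * ((n : ℚ) + 3) / 720))) - ((1 : ℚ) * ((16 * 2 ^ n - (1 + ((n : ℚ) + 4) + (((n : ℚ) + 4) * ((n : ℚ) + 3) / 2) + (((n : ℚ) + 4) * ((n : ℚ) + 3) * ((n : ℚ) + 2) / 6)) - (1 + ((n : ℚ) + 4) + (((n : ℚ) + 4) * ((n : ℚ) + 3) / 2))) / (((n : ℚ) + 4) * ((n : ℚ)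 + 3) * ((n : ℚ) + 2) / 6)) + (-(9/4) : ℚ) * ((32 * 2 ^ n - (1 + ((n : ℚ) + 5) + (((n : ℚ) + 5) * ((n : ℚ) + 4) / 2) + (((n : ℚ) + 5) * ((n : ℚ) + 4) * ((n : ℚ) + 3) / 6) + (((n : ℚ) + 5) * ((n : ℚ) + 4) * ((n : ℚ) + 3) * ((n : ℚ) + 2) / 24)) - (1 + ((n : ℚ) + 5) + (((n : ℚ) + 5) * ((n : ℚ) + 4) / 2))) / (((n : ℚ) + 5) * ((n : ℚ) + 4) * ((n : ℚ) + 3) * ((n : ℚ) + 2) / 24)) + (9/5 : ℚ) * ((64 * 2 ^ n - (1 + ((n : ℚ) + 6) + (((n : ℚ) + 6) * ((n : ℚ) + 5) / 2) + (((n : ℚ) + 6) * ((n : ℚ) + 5) * ((n : ℚ) + 4) / 6) + (((n : ℚ) + 6) * ((n : ℚ) + 5) * ((n : ℚ) + 4) * ((n : ℚ) + 3) / 24) + (((n : ℚ) + 6) * ((n : ℚ) + 5) * ((n : ℚ) + 4) * ((n : ℚ) + 3) * ((n : ℚ) + 2) / 120)) - (1 + ((n : ℚ) + 6) + (((n : ℚ)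 + 6) * ((n : ℚ) + 5) / 2))) / (((n : ℚ) + 6) * ((n : ℚ) + 5) * ((n : ℚ) + 4) * ((n : ℚ) + 3) * ((n : ℚ) + 2) / 120)) + (-(1/2) : ℚ) * ((128 * 2 ^ n - (1 + ((n : ℚ) + 7) + (((n : ℚ) + 7) * ((n : ℚ) + 6) / 2) + (((n : ℚ) + 7) * ((n : ℚ) + 6) * ((n : ℚ) + 5) / 6) + (((n : ℚ) + 7) * ((n : ℚ) + 6) * ((n : ℚ) + 5) * ((n : ℚ) + 4) / 24) + (((n : ℚ) + 7) * ((n : ℚ) + 6) * ((n : ℚ) + 5) * ((n : ℚ) + 4) * ((n : ℚ) + 3) / 120) + (((n : ℚ) + 7) * ((n : ℚ) + 6) * ((n : ℚ) + 5) * ((n : ℚ) + 4) * ((n : ℚ) + 3) * ((n : ℚ) + 2) / 720)) - (1 + ((n : ℚ) + 7) + (((n : ℚ) + 7) * ((n : ℚ) + 6) / 2))) / (((n : ℚ) + 7) * ((n : ℚ) + 6) * ((n : ℚ) + 5) * ((n : ℚ) + 4) * ((n : ℚ) + 3) * ((n : ℚ) + 2) / 720)))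

/-- `lost5Sum` as a rational function. -/
def lost5P (n : ℕ) : ℚ := ((1 : ℚ) * ((32 * 2 ^ n - (1 + ((n : ℚ) + 5) + (((n : ℚ) + 5) * ((n : ℚ) + 4) / 2) + (((n : ℚ) + 5) * ((n : ℚ) + 4) * ((n : ℚ) + 3) / 6)) - (1 + ((n : ℚ) + 5) + (((n : ℚ) + 5) * ((n : ℚ) + 4) / 2) + (((n : ℚ) + 5) * ((n : ℚ) + 4) * ((n : ℚ) + 3) / 6))) / (((n : ℚ) + 5) * ((n : ℚ) + 4) * ((n : ℚ) + 3) / 6)) + (-3 : ℚ) * ((64 * 2 ^ n - (1 + ((n : ℚ) + 6) + (((n : ℚ) + 6) * ((n : ℚ) + 5) / 2) + (((n : ℚ) + 6) * ((n : ℚ) + 5) * ((n : ℚ) + 4) / 6) + (((n : ℚ) + 6) * ((n : ℚ) + 5) * ((n : ℚ) + 4) * ((n : ℚ) + 3) / 24)) - (1 + ((n : ℚ) + 6) + (((n : ℚ) + 6) * ((n : ℚ) + 5) / 2) + (((n : ℚ) + 6) * ((n : ℚ) + 5) * ((n : ℚ) + 4) / 6))) / (((n : ℚ) + 6) * ((n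 : ℚ) + 5) * ((n : ℚ) + 4) * ((n : ℚ) + 3) / 24)) + (18/5 : ℚ) * ((128 * 2 ^ n - (1 + ((n : ℚ) + 7) + (((n : ℚ) + 7) * ((n : ℚ) + 6) / 2) + (((n : ℚ) + 7) * ((n : ℚ) + 6) * ((n : ℚ) + 5) / 6) + (((n : ℚ) + 7) * ((n : ℚ) + 6) * ((n : ℚ) + 5) * ((n : ℚ) + 4) / 24) + (((n : ℚ) + 7) * ((n : ℚ) + 6) * ((n : ℚ) + 5) * ((n : ℚ) + 4) * ((n : ℚ) + 3) / 120)) - (1 + ((n : ℚ) + 7) + (((n : ℚ) + 7) * ((n : ℚ) + 6) / 2) + (((n : ℚ) + 7) * ((n : ℚ) + 6) * ((n : ℚ) + 5) / 6))) / (((n : ℚ) + 7) * ((n : ℚ) + 6) * ((n : ℚ) + 5) * ((n : ℚ) + 4) * ((n : ℚ) + 3) / 120)) + (-2 : ℚ) * ((256 * 2 ^ n - (1 + ((n : ℚ) + 8) + (((n : ℚ) + 8) * ((n : ℚ) + 7) / 2) + (((n : ℚ) + 8) * ((n : ℚ) + 7) * ((n : ℚ) + 6) / 6) + (((n : ℚ)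 + 8) * ((n : ℚ) + 7) * ((n : ℚ) + 6) * ((n : ℚ) + 5) / 24) + (((n : ℚ) + 8) * ((n : ℚ) + 7) * ((n : ℚ) + 6) * ((n : ℚ) + 5) * ((n : ℚ) + 4) / 120) + (((n : ℚ) + 8) * ((n : ℚ) + 7) * ((n : ℚ) + 6) * ((n : ℚ) + 5) * ((n : ℚ) + 4) * ((n : ℚ) + 3) / 720)) - (1 + ((n : ℚ) + 8) + (((n : ℚ) + 8) * ((n : ℚ) + 7) / 2) + (((n : ℚ) + 8) * ((n : ℚ) + 7) * ((n : ℚ) + 6) / 6))) / (((n : ℚ) + 8) * ((n : ℚ) + 7) * ((n : ℚ) + 6) * ((n : ℚ) + 5) * ((n : ℚ) + 4) * ((n : ℚ) + 3) / 720)) + (3/7 : ℚ) * ((512 * 2 ^ n - (1 + ((n : ℚ) + 9) + (((n : ℚ) + 9) * ((n : ℚ) + 8) / 2) + (((n : ℚ) + 9) * ((n : ℚ) + 8) * ((n : ℚ) + 7) / 6) + (((n : ℚ) + 9) * ((n : ℚ) + 8) * ((n : ℚ) + 7) * ((n : ℚ) + 6) / 24) + (((n : ℚ) + 9) * ((n :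 ℚ) + 8) * ((n : ℚ) + 7) * ((n : ℚ) + 6) * ((n : ℚ) + 5) / 120) + (((n : ℚ) + 9) * ((n : ℚ) + 8) * ((n : ℚ) + 7) * ((n : ℚ) + 6) * ((n : ℚ) + 5) * ((n : ℚ) + 4) / 720) + (((n : ℚ) + 9) * ((n : ℚ) + 8) * ((n : ℚ) + 7) * ((n : ℚ) + 6) * ((n : ℚ) + 5) * ((n : ℚ) + 4) * ((n : ℚ) + 3) / 5040)) - (1 + ((n : ℚ) + 9) + (((n : ℚ) + 9) * ((n : ℚ) + 8) / 2) + (((n : ℚ) + 9) * ((n : ℚ) + 8) * ((n : ℚ) + 7) / 6))) / (((n : ℚ) + 9) * ((n : ℚ) + 8) * ((n : ℚ) + 7) * ((n : ℚ) + 6) * ((n : ℚ) + 5) * ((n : ℚ) + 4) * ((n : ℚ) + 3) / 5040))) - ((1 : ℚ) * ((16 * 2 ^ n - (1 + ((n : ℚ) + 4) + (((n : ℚ) + 4) * ((n : ℚ) + 3) / 2) + (((n : ℚ) + 4) * ((n : ℚ) + 3) * ((n : ℚ) + 2) / 6)) - (1 + ((n : ℚ) + 4) + (((n : ℚ) + 4)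 * ((n : ℚ) + 3) / 2))) / (((n : ℚ) + 4) * ((n : ℚ) + 3) * ((n : ℚ) + 2) / 6)) + (-3 : ℚ) * ((32 * 2 ^ n - (1 + ((n : ℚ) + 5) + (((n : ℚ) + 5) * ((n : ℚ) + 4) / 2) + (((n : ℚ) + 5) * ((n : ℚ) + 4) * ((n : ℚ) + 3) / 6) + (((n : ℚ) + 5) * ((n : ℚ) + 4) * ((n : ℚ) + 3) * ((n : ℚ) + 2) / 24)) - (1 + ((n : ℚ) + 5) + (((n : ℚ) + 5) * ((n : ℚ) + 4) / 2))) / (((n : ℚ) + 5) * ((n : ℚ) + 4) * ((n : ℚ) + 3) * ((n : ℚ) + 2) / 24)) + (18/5 : ℚ) * ((64 * 2 ^ n - (1 + ((n : ℚ) + 6) + (((n : ℚ) + 6) * ((n : ℚ) + 5) / 2) + (((n : ℚ) + 6) * ((n : ℚ) + 5) * ((n : ℚ) + 4) / 6) + (((n : ℚ) + 6) * ((n : ℚ) + 5) * ((n : ℚ) + 4) * ((n : ℚ) + 3) / 24) + (((n : ℚ) + 6) * ((n : ℚ) + 5) * ((n : ℚ) + 4) * ((n : ℚ) + 3) * ((n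 : ℚ) + 2) / 120)) - (1 + ((n : ℚ) + 6) + (((n : ℚ) + 6) * ((n : ℚ) + 5) / 2))) / (((n : ℚ) + 6) * ((n : ℚ) + 5) * ((n : ℚ) + 4) * ((n : ℚ) + 3) * ((n : ℚ) + 2) / 120)) + (-2 : ℚ) * ((128 * 2 ^ n - (1 + ((n : ℚ) + 7) + (((n : ℚ) + 7) * ((n : ℚ) + 6) / 2) + (((n : ℚ) + 7) * ((n : ℚ) + 6) * ((n : ℚ) + 5) / 6) + (((n : ℚ) + 7) * ((n : ℚ) + 6) * ((n : ℚ) + 5) * ((n : ℚ) + 4) / 24) + (((n : ℚ) + 7) * ((n : ℚ) + 6) * ((n : ℚ) + 5) * ((n : ℚ) + 4) * ((n : ℚ) + 3) / 120) + (((n : ℚ) + 7) * ((n : ℚ) + 6) * ((n : ℚ) + 5) * ((n : ℚ) + 4) * ((n : ℚ) + 3) * ((n : ℚ) + 2) / 720)) - (1 + ((n : ℚ) + 7) + (((n : ℚ) + 7) * ((n : ℚ) + 6) / 2))) / (((n : ℚ) + 7) * ((n : ℚ) + 6) * ((n : ℚ) + 5) * ((n : ℚ) + 4) * ((n : ℚ)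 + 3) * ((n : ℚ) + 2) / 720)) + (3/7 : ℚ) * ((256 * 2 ^ n - (1 + ((n : ℚ) + 8) + (((n : ℚ) + 8) * ((n : ℚ) + 7) / 2) + (((n : ℚ) + 8) * ((n : ℚ) + 7) * ((n : ℚ) + 6) / 6) + (((n : ℚ) + 8) * ((n : ℚ) + 7) * ((n : ℚ) + 6) * ((n : ℚ) + 5) / 24) + (((n : ℚ) + 8) * ((n : ℚ) + 7) * ((n : ℚ) + 6) * ((n : ℚ) + 5) * ((n : ℚ) + 4) / 120) + (((n : ℚ) + 8) * ((n : ℚ) + 7) * ((n : ℚ) + 6) * ((n : ℚ) + 5) * ((n : ℚ) + 4) * ((n : ℚ) + 3) / 720) + (((n : ℚ) + 8) * ((n : ℚ) + 7) * ((n : ℚ) + 6) * ((n : ℚ) + 5) * ((n : ℚ) + 4) * ((n : ℚ) + 3) * ((n : ℚ) + 2) / 5040)) - (1 + ((n : ℚ) + 8) + (((n : ℚ) + 8) * ((n : ℚ) + 7) / 2))) / (((n : ℚ) + 8) * ((n : ℚ) + 7) * ((n : ℚ) + 6) * ((n : ℚ) + 5) * ((n : ℚ) + 4) * ((n : ℚ)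 + 3) * ((n : ℚ) + 2) / 5040)))

/-- `l1aSum = l1aP`. -/
theorem l1a_eq_P (n : ℕ) : l1aSum n = l1aP n := by
  rw [l1a_closed]; unfold l1aP
  push_cast
  simp only [pow_add]
  ring_nf

/-- `l1bSum = l1bP` (`n ≥ 1`). -/
theorem l1b_eq_P (n : ℕ) (hn : 1 ≤ n) : l1bSum n = l1bP n := by
  rw [l1b_closed n hn]; unfold l1bP
  push_cast
  simp only [pow_add]
  ring_nf

/-- `l2aSum = l2aP`. -/
theorem l2a_eq_P (n : ℕ) : l2aSum n = l2aP n := by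
  rw [l2a_closed]; unfold l2aP
  push_cast
  simp only [pow_add]
  ring_nf

/-- `l2bSum = l2bP` (`n ≥ 1`). -/
theorem l2b_eq_P (n : ℕ) (hn : 1 ≤ n) : l2bSum n = l2bP n := by
  rw [l2b_closed n hn]; unfold l2bP; ring

/-- `lost4Sum = lost4P` (`n ≥ 2`). -/
theorem lost4_eq_P (n : ℕ) (hn : 2 ≤ n) : lost4Sum n = lost4P n := by
  rw [lost4_closed, texp_7_2 n hn, U1.texp_7_1 n hn]; unfold lost4P
  simp only [U1.choose_six_cast, U0.choose_five_cast, U0.choose_four_cast, U0.choose_three_cast, U0.choose_two_cast]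
  push_cast
  simp only [pow_add]
  ring_nf

/-- `lost5Sum = lost5P` (`n ≥ 2`). -/
theorem lost5_eq_P (n : ℕ) (hn : 2 ≤ n) : lost5Sum n = lost5P n := by
  rw [lost5_closed, texp_8_2 n hn, U1.texp_8_1 n hn]; unfold lost5P
  simp only [U1.choose_seven_cast, U1.choose_six_cast, U0.choose_five_cast, U0.choose_four_cast, U0.choose_three_cast, U0.choose_two_cast]
  push_cast
  simp only [pow_add]
  ring_nf

end PercRepro.NightThree.U0
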